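import Summits.HodgeConjecture.CorCM.Census.CoinvariantSplitCyclic
import Summits.HodgeConjecture.CorCM.FaceCoinvariantFloor
import HarnessLib

/-!
# The face-coinvariant floor, split-cyclic Galois groups: `φ₂(F) = β(F) − 2`

COR-CM (cell `pub-hodgecm2`), count-neutral kernel combinatorics by the binder seat b09 (gen 29; lane COINVARIANT-FLOOR): the
intrinsic form, for a Galois CM field `F`, of `Census/CoinvariantSplitCyclic.lean` (VIII); sequel of `CorCM/FaceCoinvariantFloor.lean`.
Theorems only; no `decide`, no certificate, no named fact, no `sorry`.  HONEST FRAMING: `HC_CM` is NOT proved; nothing here is a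
period.  T5: n/a-class (no named-fact / conjecture-def binder; the split hypothesis is two plain binders on `GalT F`).

THE STATEMENT (`fibreTwo_add_two_eq_card_block_of_split`).  If the Galois translates of `F` are `GalT F = ⟨g⟩ ⊔ conjT·⟨g⟩` with
`conjT ∉ ⟨g⟩` and `ord g` even — i.e. `Gal(F/ℚ) ≅ C₂ × C_m`, `m` even, complex conjugation generating the `C₂` (e.g. `F = L(√−d)` for a
real cyclic field `L` of even degree `m`) — then **`φ₂(F) + 2 = β(F)`**: a face-period route for `F` needs at least `β(F) − 2` faces
by the coinvariant floor, and this is also all that base-change-invariant mod-`2` functionals can give (`φ₂ = dim span par(faces)`).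
With `FaceCoinvariantFloor` §5 (cyclic: `φ₂ + 1 = β`) this settles `φ₂` in closed form for every Galois CM field with
`Gal(F/ℚ) ≅ C₂ × C_m` in which complex conjugation is the `C₂`-factor or `C_{2m}` is cyclic.

## References
* [Pohlmann1968] H. Pohlmann, Algebraic cycles on abelian varieties of complex multiplication type, Ann. of Math. 88 (1968), Thm 1.
* [Milne1999] J. S. Milne, Lefschetz motives and the Tate conjecture, Compositio Math. 117 (1999), Prop. 2.1, p. 54.
-/

noncomputable section

open NumberField NumberField.ComplexEmbedding

namespace Summit.HodgeConjecture.CorCM.FaceCoinvariant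

open Literature.AlgebraicGeometry.Motives (CMType)
open Summit.HodgeConjecture.CorCM.Prior.AllgGroup.RfwfAllgGroup
open Summit.HodgeConjecture.CorCM.Census.BlockParity
open Summit.HodgeConjecture.CorCM.Census.Coinvariant

variable {F : Type} [Field F] [NumberField F]

/-- **Split-cyclic Galois group: `φ₂(F) + 2 = β(F)`** (`GalT F = ⟨g⟩ ⊔ conjT·⟨g⟩`, `conjT ∉ ⟨g⟩`, `ord g` even). [folklore] -/
theorem fibreTwo_add_two_eq_card_block_of_split [IsCMField F] [IsGalois ℚ F] {g : GalT F}
    (hcov : ∀ Q : GalT F, (∃ k : ℕ, Q = g ^ k) ∨ ∃ k : ℕ, Q = conjT * g ^ k) (hng : ∀ k : ℕ, (conjT : GalT F) ≠ g ^ k)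
    (hm : Even (orderOf g)) :
    fibreTwo (conjT : GalT F) conjT_mul_self + 2 = Fintype.card (Block (conjT : GalT F)) :=
  Census.Coinvariant.fibreTwo_add_two_eq_card_block_of_split conjT conjT_mul_self conjT_ne_one
    (fun P => FaceBasis.conjT_comm P) hcov hng hm

/-- **… with an `hgen` set of faces: `β(F) ≤ |𝒮| + 2` is then sharp for the coinvariant method** (`φ₂(F) = β(F) − 2 ≤ |𝒮|`).
[folklore] -/
theorem card_block_le_card_add_two_of_hgen_of_split [IsCMField F] [IsGalois ℚ F] {g : GalT F}
    (hcov : ∀ Q : GalT F, (∃ k : ℕ, Q = g ^ k) ∨ ∃ k : ℕ, Q = conjT * g ^ k) (hng : ∀ k : ℕ, (conjT : GalT F) ≠ g ^ k)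
    (hm : Even (orderOf g)) (𝒮 : Finset (Face F)) (σ₀ : F →+* ℂ)
    (hgen : ∀ f : Face F, lefChar f.corner (fun _ => ({σ₀} : Finset (F →+* ℂ))) ∈ AddSubgroup.closure
      {a : Asym F | ∃ g ∈ (𝒮 : Set (Face F)), ∃ σ : F →+* ℂ, a = lefChar g.corner (fun _ => ({σ} : Finset (F →+* ℂ)))}) :
    Fintype.card (Block (conjT : GalT F)) ≤ 𝒮.card + 2 ∧ fibreTwo (conjT : GalT F) conjT_mul_self ≤ 𝒮.card := by
  have h1 := fibreTwo_le_card_of_hgen 𝒮 σ₀ hgen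
  have h2 := fibreTwo_add_two_eq_card_block_of_split hcov hng hm
  exact ⟨by omega, h1⟩

/-- In the split-cyclic case the degree is `[F:ℚ] = 2·ord g`. [folklore] -/
theorem finrank_eq_two_mul_orderOf_of_split [IsGalois ℚ F] {g : GalT F}
    (hcov : ∀ Q : GalT F, (∃ k : ℕ, Q = g ^ k) ∨ ∃ k : ℕ, Q = conjT * g ^ k) (hng : ∀ k : ℕ, (conjT : GalT F) ≠ g ^ k) :
    Module.finrank ℚ F = 2 * orderOf g := by
  rw [← FaceCensus.card_galT (F := F)]
  exact card_eq_two_mul_orderOf_of_split conjT hcov hng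

end Summit.HodgeConjecture.CorCM.FaceCoinvariant

end
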